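import Summits.AtomisticToContinuum.Crystallization.Theorems.GapTwelveToBarlow.Negative.PairSumObstruction
import Literature.Geometry.DiscreteGeometry.KissingRigidity

/-!
# Negative knowledge for crux `SquareWellLayerCake.GapTwelveToBarlow` (stmt-AtomisticToContinuum-15807), IV:
# gap-twelve does not give Barlow even POINTWISE and even for EXACT kissing — the `D₅ₕ` shell
# (standing disprover, cycle 1; supports 15807)

* §1 `InDiffLattice`, `InDiffLattice.dichotomy`, `not_matched_of_short_combination` — the lattice of
  differences of a Barlow template (`Negative.PairSumObstruction.pairSum_dichotomy`) for arbitrary INTEGER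
  COMBINATIONS: if site `i` has `R`-neighbours `j t` and integers `c t` with
  `(∑ |c t|) ε < ‖∑ c t • (x (j t) − x i)‖` and `(‖∑ c t • (x (j t) − x i)‖ + (∑ |c t|) ε)² < 1/12`, then `i` is
  matched to NO Barlow template (`a, h > 1/2`; any `s, z, A`).
* §2 `deca` — the thirteen-point decahedral-axis cluster (centre, two poles at distance `1`, two ALIGNED
  pentagonal rings of radius `0.988`; integer coordinates in units of `1/1005`, the cluster of the barrier
  `Literature.Barriers.AtomisticToContinuum.DecahedralSoftShell` rescaled): its centre IS Good for the crux's
  hypothesis predicate (`good_deca`: twelve neighbours at distances in `[0.987, 1]`, all pairs `≥ 0.987 ≥ 55/57`,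
  nothing else) and is NOT `(1, 1/500)`-matched (`not_matched_deca`): the golden-ratio combination
  `−3(u₀ + ℓ₀) + 5(u₁ + ℓ₁ + u₄ + ℓ₄)` of ring offsets has norm `164/1005 ≈ 0.163 ∈ (26ε, 1/(2√3) − 26ε)`.
* `exists_good_not_matched` — hence `Good x i → Matched 1 ε x i` FAILS pointwise for every `ε ≤ 1/500`, with
  zero strain at the centre: any proof of K3 must propagate through the neighbours' shells (the a.e.
  hypothesis) and/or use minimality; five-fold centres must be shown to have density `→ 0` in ground states
  (cf. crux-dir `BarrierNotesIdeator1.md` §B2: one infinite five-fold LINE is an all-Good configuration).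

Nothing here closes an item; no theorem concludes a Theses decl.
-/

noncomputable section

open scoped BigOperators
open Filter Topology

namespace Summit.AtomisticToContinuum.Crystallization.Theorems.GapTwelveToBarlow.Negative.FiveFoldShell

open Literature.MathematicalPhysics.StatisticalMechanics Literature.Geometry.DiscreteGeometry
open Summit.AtomisticToContinuum.Crystallization.Theorems.GapTwelveToBarlow.Negative.PairSumObstruction

/-! ## §1 The difference lattice and integer combinations -/

/-- `v` lies in the difference lattice `Λ*(a) ⊕ hℤe₃` of the Barlow templates with parameters `a, h`:
coordinates `(a P/2, a√3 Q/6, K h)` with integers `P ≡ Q (mod 2)`, `K`. -/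
def InDiffLattice (a h : ℝ) (v : EuclideanSpace ℝ (Fin 3)) : Prop :=
  ∃ P Q K : ℤ, Even (P - Q) ∧ v 0 = a / 2 * P ∧ v 1 = a * √3 / 6 * Q ∧ v 2 = K * h

/-- `0` is in the difference lattice. -/
theorem inDiffLattice_zero (a h : ℝ) : InDiffLattice a h 0 :=
  ⟨0, 0, 0, by simp, by simp, by simp, by simp⟩

/-- The difference lattice is closed under addition. -/
theorem InDiffLattice.add {a h : ℝ} {v w : EuclideanSpace ℝ (Fin 3)} (hv : InDiffLattice a h v)
    (hw : InDiffLattice a h w) : InDiffLattice a h (v + w) := by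
  obtain ⟨P, Q, K, hpar, h0, h1, h2⟩ := hv
  obtain ⟨P', Q', K', hpar', h0', h1', h2'⟩ := hw
  refine ⟨P + P', Q + Q', K + K', ?_, ?_, ?_, ?_⟩
  · have : P + P' - (Q + Q') = (P - Q) + (P' - Q') := by ring
    rw [this]; exact hpar.add hpar'
  · rw [PiLp.add_apply, h0, h0']; push_cast; ring
  · rw [PiLp.add_apply, h1, h1']; push_cast; ring
  · rw [PiLp.add_apply, h2, h2']; push_cast; ring

/-- The difference lattice is closed under integer multiples. -/
theorem InDiffLattice.zsmul {a h : ℝ} {v : EuclideanSpace ℝ (Fin 3)} (c : ℤ) (hv : InDiffLattice a h v) :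
    InDiffLattice a h ((c : ℝ) • v) := by
  obtain ⟨P, Q, K, hpar, h0, h1, h2⟩ := hv
  refine ⟨c * P, c * Q, c * K, ?_, ?_, ?_, ?_⟩
  · have : c * P - c * Q = c * (P - Q) := by ring
    rw [this]; exact hpar.mul_left c
  · rw [PiLp.smul_apply, smul_eq_mul, h0]; push_cast; ring
  · rw [PiLp.smul_apply, smul_eq_mul, h1]; push_cast; ring
  · rw [PiLp.smul_apply, smul_eq_mul, h2]; push_cast; ring

/-- Differences of template points lie in the difference lattice. [folklore] -/
theorem inDiffLattice_barlowPos_sub (a h : ℝ) (s : ℤ → ℤ) (k i j k' i' j' : ℤ) :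
    InDiffLattice a h (barlowPos a h s k i j - barlowPos a h s k' i' j') := by
  refine ⟨2 * (i - i') + (j - j') + (haggLabel s k - haggLabel s k'),
    3 * (j - j') + (haggLabel s k - haggLabel s k'), k - k', ?_, ?_, ?_, ?_⟩
  · exact ⟨(i - i') - (j - j'), by ring⟩
  · simp only [PiLp.sub_apply, barlowPos_apply_zero]; push_cast; ring
  · simp only [PiLp.sub_apply, barlowPos_apply_one]; push_cast; ring
  · simp only [PiLp.sub_apply, barlowPos_apply_two]; push_cast; ring

/-- **Dichotomy**: a difference-lattice vector is `0` or has squared norm `≥ min (a²/3) h²`. [folklore] -/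
theorem InDiffLattice.dichotomy {a h : ℝ} {v : EuclideanSpace ℝ (Fin 3)} (hv : InDiffLattice a h v) :
    v = 0 ∨ min (a ^ 2 / 3) (h ^ 2) ≤ ‖v‖ ^ 2 := by
  obtain ⟨P, Q, K, hpar, h0, h1, h2⟩ := hv
  have h3 : (√3 : ℝ) ^ 2 = 3 := Real.sq_sqrt (by norm_num)
  have hnorm : ‖v‖ ^ 2 = a ^ 2 / 12 * (3 * (P : ℝ) ^ 2 + (Q : ℝ) ^ 2) + (K : ℝ) ^ 2 * h ^ 2 := by
    rw [EuclideanSpace.norm_eq, Real.sq_sqrt (Finset.sum_nonneg fun _ _ => by positivity),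
      Fin.sum_univ_three, Real.norm_eq_abs, Real.norm_eq_abs, Real.norm_eq_abs, sq_abs, sq_abs, sq_abs,
      h0, h1, h2]
    linear_combination (a ^ 2 / 36 * (Q : ℝ) ^ 2) * h3
  by_cases hK0 : K = 0
  · by_cases hPQ : P = 0 ∧ Q = 0
    · left
      ext l
      fin_cases l
      · simpa [hPQ.1] using h0
      · simpa [hPQ.2] using h1
      · simpa [hK0] using h2
    · right
      have h4 : (4 : ℝ) ≤ 3 * (P : ℝ) ^ 2 + (Q : ℝ) ^ 2 := by exact_mod_cast four_le_of_parity hpar hPQ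
      calc min (a ^ 2 / 3) (h ^ 2) ≤ a ^ 2 / 3 := min_le_left _ _
        _ ≤ a ^ 2 / 12 * (3 * (P : ℝ) ^ 2 + (Q : ℝ) ^ 2) + (K : ℝ) ^ 2 * h ^ 2 := by
            nlinarith [sq_nonneg a, sq_nonneg ((K : ℝ) * h)]
        _ = ‖v‖ ^ 2 := hnorm.symm
  · right
    have hK1 : (1 : ℝ) ≤ (K : ℝ) ^ 2 := by
      exact_mod_cast (one_le_sq_iff_one_le_abs _).2 (Int.one_le_abs hK0)
    calc min (a ^ 2 / 3) (h ^ 2) ≤ h ^ 2 := min_le_right _ _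
      _ ≤ a ^ 2 / 12 * (3 * (P : ℝ) ^ 2 + (Q : ℝ) ^ 2) + (K : ℝ) ^ 2 * h ^ 2 := by
          nlinarith [sq_nonneg a, sq_nonneg h, sq_nonneg (P : ℝ), sq_nonneg (Q : ℝ)]
      _ = ‖v‖ ^ 2 := hnorm.symm

/-- Integer combinations of differences `p t − z` of template points lie in the difference lattice. -/
theorem inDiffLattice_sum {a h : ℝ} {s : ℤ → ℤ} {m : ℕ} (c : Fin m → ℤ)
    (p : Fin m → EuclideanSpace ℝ (Fin 3)) (z : EuclideanSpace ℝ (Fin 3))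
    (hp : ∀ t, p t ∈ barlowStacking a h s) (hz : z ∈ barlowStacking a h s) :
    InDiffLattice a h (∑ t, (c t : ℝ) • (p t - z)) := by
  obtain ⟨k₀, i₀, j₀, rfl⟩ := hz
  induction (Finset.univ : Finset (Fin m)) using Finset.induction_on with
  | empty => simpa using inDiffLattice_zero a h
  | insert t S htS ih =>
    rw [Finset.sum_insert htS]
    refine InDiffLattice.add (InDiffLattice.zsmul (c t) ?_) ih
    obtain ⟨k, i, j, hk⟩ := hp t
    rw [hk]
    exact inDiffLattice_barlowPos_sub a h s k i j k₀ i₀ j₀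

/-- **Combination obstruction.**  If site `i` has `R`-neighbours `j t` (`t : Fin m`) and integer
coefficients `c t` such that `w := ∑ c t • (x (j t) − x i)` satisfies `(∑ |c t|) ε < ‖w‖` and
`(‖w‖ + (∑ |c t|) ε)² < 1/12`, then `i` is `(R, ε)`-matched to NO Barlow template (`a, h > 1/2`; any
`s, z, A`): the matched template points would combine to a difference-lattice vector of norm in
`(0, 1/(2√3))`. [folklore] -/
theorem not_matched_of_short_combination {N m : ℕ} {x : Fin N → EuclideanSpace ℝ (Fin 3)} {i : Fin N}
    (j : Fin m → Fin N) (c : Fin m → ℤ) {R ε : ℝ} (hjR : ∀ t, dist (x (j t)) (x i) ≤ R)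
    (hlow : (∑ t, |(c t : ℝ)|) * ε < ‖∑ t, (c t : ℝ) • (x (j t) - x i)‖)
    (hup : (‖∑ t, (c t : ℝ) • (x (j t) - x i)‖ + (∑ t, |(c t : ℝ)|) * ε) ^ 2 < 1 / 12) :
    ¬ Matched R ε x i := by
  rintro ⟨a, h, ha, -, hh, -, s, -, z, hz, A, -, h2⟩
  choose p hp hpx using fun t => h2 (j t) (hjR t)
  set w := ∑ t, (c t : ℝ) • (x (j t) - x i) with hw
  set v := ∑ t, (c t : ℝ) • (p t - z) with hv
  have hvL : InDiffLattice a h v := inDiffLattice_sum c p z hp hz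
  -- `‖w − A v‖ ≤ (∑ |c|) ε`
  have hAv : A v = ∑ t, (c t : ℝ) • A (p t - z) := by
    rw [hv, map_sum]; simp only [map_smul]
  have htri : ‖w - A v‖ ≤ (∑ t, |(c t : ℝ)|) * ε := by
    have hdiff : w - A v = ∑ t, (c t : ℝ) • ((x (j t) - x i) - A (p t - z)) := by
      rw [hw, hAv, ← Finset.sum_sub_distrib]
      refine Finset.sum_congr rfl fun t _ => ?_
      exact (smul_sub _ _ _).symm
    rw [hdiff, Finset.sum_mul]
    refine (norm_sum_le _ _).trans (Finset.sum_le_sum fun t _ => ?_)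
    rw [norm_smul, Real.norm_eq_abs]
    refine mul_le_mul_of_nonneg_left ?_ (abs_nonneg _)
    have := hpx t
    rw [dist_eq_norm] at this
    have e1 : x (j t) - (x i + A (p t - z)) = (x (j t) - x i) - A (p t - z) := by abel
    rwa [e1] at this
  have hnAv : ‖A v‖ = ‖v‖ := A.norm_map _
  have hlow' : ‖w‖ - (∑ t, |(c t : ℝ)|) * ε ≤ ‖v‖ := by
    have := norm_sub_norm_le w (A v); linarith
  have hup' : ‖v‖ ≤ ‖w‖ + (∑ t, |(c t : ℝ)|) * ε := by
    have := norm_sub_norm_le (A v) w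
    rw [norm_sub_rev] at this; linarith
  rcases hvL.dichotomy with h0 | hmin
  · rw [h0, norm_zero] at hlow'; linarith
  · have hmin' : (1 : ℝ) / 12 < min (a ^ 2 / 3) (h ^ 2) := by
      rw [lt_min_iff]; constructor <;> nlinarith
    have hnn : 0 ≤ ‖v‖ := norm_nonneg _
    have hsq : ‖v‖ ^ 2 ≤ (‖w‖ + (∑ t, |(c t : ℝ)|) * ε) ^ 2 := pow_le_pow_left₀ hnn hup' 2
    linarith

/-! ## §2 The decahedral-axis (`D₅ₕ`) cluster -/

/-- Integer coordinates (units of `1/1005`) of the thirteen-point decahedral-axis cluster: `0` the centre,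
`1, 2` the poles, `3 … 7` the upper ring (`k = 0, …, 4` at azimuth `72 k°`), `8 … 12` the lower ring
(aligned with the upper one). -/
def decaInt : Fin 13 → Fin 3 → ℤ :=
  ![![0, 0, 0], ![0, 0, 1005], ![0, 0, -1005],
    ![856, 0, 503], ![265, 814, 503], ![-693, 503, 503], ![-693, -503, 503], ![265, -814, 503],
    ![856, 0, -503], ![265, 814, -503], ![-693, 503, -503], ![-693, -503, -503], ![265, -814, -503]]

/-- The cluster in `ℝ³`. -/
def deca : Fin 13 → EuclideanSpace ℝ (Fin 3) := fun n => (1005 : ℝ)⁻¹ • intVec (decaInt n)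

/-- Integer certificate: every point is within `1005` of the centre, every pair of distinct points is
`≥ √980000 > 1005·55/57` apart. -/
theorem decaInt_cert :
    (∀ n : Fin 13, sqNormInt (decaInt n - decaInt 0) ≤ 1005 ^ 2) ∧
    (∀ n n' : Fin 13, n ≠ n' → 980000 ≤ sqNormInt (decaInt n - decaInt n')) := by
  refine ⟨by decide, by decide⟩

/-- Distances in the cluster from the integer certificate. -/
theorem dist_deca (n n' : Fin 13) :
    dist (deca n) (deca n') = (1005 : ℝ)⁻¹ * Real.sqrt (sqNormInt (decaInt n - decaInt n') : ℝ) := by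
  rw [dist_eq_norm, deca, deca, ← smul_sub, intVec_sub, norm_smul, norm_inv, Real.norm_of_nonneg
    (by norm_num), norm_intVec]

/-- Every point is within distance `1` of the centre. -/
theorem dist_deca_zero_le (n : Fin 13) : dist (deca 0) (deca n) ≤ 1 := by
  rw [dist_comm, dist_deca]
  have h1 : (sqNormInt (decaInt n - decaInt 0) : ℝ) ≤ (1005 : ℝ) ^ 2 := by
    exact_mod_cast decaInt_cert.1 n
  have h2 : Real.sqrt (sqNormInt (decaInt n - decaInt 0) : ℝ) ≤ 1005 := by
    calc Real.sqrt (sqNormInt (decaInt n - decaInt 0) : ℝ) ≤ Real.sqrt ((1005 : ℝ) ^ 2) :=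
          Real.sqrt_le_sqrt h1
      _ = 1005 := Real.sqrt_sq (by norm_num)
  have := mul_le_mul_of_nonneg_left h2 (by norm_num : (0 : ℝ) ≤ (1005 : ℝ)⁻¹)
  linarith [this]

/-- Distinct points are `≥ 55/57` apart. -/
theorem le_dist_deca {n n' : Fin 13} (h : n ≠ n') : (55 : ℝ) / 57 ≤ dist (deca n) (deca n') := by
  rw [dist_deca]
  have h1 : (980000 : ℝ) ≤ (sqNormInt (decaInt n - decaInt n') : ℝ) := by
    exact_mod_cast decaInt_cert.2 n n' h
  have h2 : (985 : ℝ) ≤ Real.sqrt (sqNormInt (decaInt n - decaInt n') : ℝ) := by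
    rw [Real.le_sqrt (by norm_num) (by linarith)]; linarith
  have := mul_le_mul_of_nonneg_left h2 (by norm_num : (0 : ℝ) ≤ (1005 : ℝ)⁻¹)
  linarith [this, show (55 : ℝ) / 57 ≤ (1005 : ℝ)⁻¹ * 985 by norm_num]

/-- **The centre of the `D₅ₕ` cluster is Good** for the crux's hypothesis predicate (exactly twelve within
`1`, nothing else at all, every pair `≥ 55/57`). -/
theorem good_deca : Good deca 0 := by
  classical
  refine ⟨?_, ?_, ?_⟩
  · intro n _ n' hn'
    exact le_dist_deca (Ne.symm hn')
  · have : (Finset.univ.filter fun n : Fin 13 => n ≠ 0 ∧ dist (deca 0) (deca n) ≤ 1) =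
        Finset.univ.filter fun n : Fin 13 => n ≠ 0 := by
      ext n
      simp only [Finset.mem_filter, Finset.mem_univ, true_and, and_iff_left_iff_imp]
      exact fun _ => dist_deca_zero_le n
    rw [this]
    decide
  · calc (Finset.univ.filter fun n : Fin 13 => n ≠ 0 ∧ dist (deca 0) (deca n) ≤ 11 / 10).card
        ≤ (Finset.univ.filter fun n : Fin 13 => n ≠ 0).card :=
          Finset.card_le_card (fun n hn => by
            simp only [Finset.mem_filter, Finset.mem_univ, true_and] at hn ⊢; exact hn.1)
      _ = 12 := by decide

/-- The six ring neighbours used by the golden-ratio combination: `u₀, ℓ₀, u₁, ℓ₁, u₄, ℓ₄`. -/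
def ringIdx : Fin 6 → Fin 13 := ![3, 8, 4, 9, 7, 12]

/-- Their coefficients `−3, −3, 5, 5, 5, 5` (`5/3 ≈ φ`: `−3·2·856 + 5·4·265 = 164` in units of `1/1005`). -/
def ringCoeff : Fin 6 → ℤ := ![-3, -3, 5, 5, 5, 5]

/-- `intVec` as an additive monoid homomorphism. -/
def intVecHom : (Fin 3 → ℤ) →+ EuclideanSpace ℝ (Fin 3) where
  toFun := intVec
  map_zero' := by ext l; simp [intVec]
  map_add' v w := by ext l; simp [intVec]

/-- `intVec` commutes with finite sums. -/
theorem intVec_sum {ι : Type*} (S : Finset ι) (g : ι → Fin 3 → ℤ) :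
    intVec (∑ t ∈ S, g t) = ∑ t ∈ S, intVec (g t) :=
  map_sum intVecHom g S

/-- The integer combination behind the golden-ratio defect: `−3·(u₀ + ℓ₀) + 5·(u₁ + ℓ₁ + u₄ + ℓ₄) = (164, 0, 0)`. -/
theorem sum_ringCoeff_int : ∑ t, ringCoeff t • (decaInt (ringIdx t) - decaInt 0) = ![164, 0, 0] := by
  decide

/-- The golden-ratio combination of the ring offsets is the short vector `(164/1005, 0, 0)`. -/
theorem sum_ringCoeff_smul :
    ∑ t, (ringCoeff t : ℝ) • (deca (ringIdx t) - deca 0) = (1005 : ℝ)⁻¹ • intVec ![164, 0, 0] := by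
  have h1 : ∀ t, (ringCoeff t : ℝ) • (deca (ringIdx t) - deca 0) =
      (1005 : ℝ)⁻¹ • intVec (ringCoeff t • (decaInt (ringIdx t) - decaInt 0)) := by
    intro t
    rw [deca, deca, ← smul_sub, intVec_sub, smul_comm, intVec_zsmul]
  rw [Finset.sum_congr rfl (fun t _ => h1 t), ← Finset.smul_sum, ← intVec_sum, sum_ringCoeff_int]

/-- Its norm is `164/1005`. -/
theorem norm_sum_ringCoeff_smul : ‖∑ t, (ringCoeff t : ℝ) • (deca (ringIdx t) - deca 0)‖ = 164 / 1005 := by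
  rw [sum_ringCoeff_smul, norm_smul, norm_inv, Real.norm_of_nonneg (by norm_num), norm_intVec]
  have hint : sqNormInt ![164, 0, 0] = 164 ^ 2 := by decide
  have : (sqNormInt ![164, 0, 0] : ℝ) = (164 : ℝ) ^ 2 := by exact_mod_cast hint
  rw [this, Real.sqrt_sq (by norm_num)]
  norm_num

/-- The total coefficient weight is `26`. -/
theorem sum_abs_ringCoeff : ∑ t, |(ringCoeff t : ℝ)| = 26 := by
  have hint : ∑ t, |ringCoeff t| = 26 := by decide
  exact_mod_cast hint

/-- **The centre of the `D₅ₕ` cluster is not `(1, 1/500)`-matched** to any Barlow template: the golden-ratio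
combination has norm `164/1005 ≈ 0.163 ∈ (26/500, 1/(2√3) − 26/500)`. -/
theorem not_matched_deca : ¬ Matched 1 (1 / 500) deca 0 := by
  refine not_matched_of_short_combination ringIdx ringCoeff (fun t => ?_) ?_ ?_
  · rw [dist_comm]; exact dist_deca_zero_le _
  · rw [norm_sum_ringCoeff_smul, sum_abs_ringCoeff]; norm_num
  · rw [norm_sum_ringCoeff_smul, sum_abs_ringCoeff]; norm_num

/-- **Gap-twelve does not imply Barlow, pointwise**: there is a finite configuration with a site that is
Good (exactly twelve neighbours at distances in `[55/57, 1]`, all pairs `55/57`-separated, nothing in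
`(1, 11/10]`) and NOT `(1, ε)`-matched for any `ε ≤ 1/500`.  K3 is therefore an essentially GLOBAL /
energetic statement: the implication must come from the neighbours' shells (a.e. Good) and minimality. -/
theorem exists_good_not_matched {ε : ℝ} (hε : 0 < ε) (hε' : ε ≤ 1 / 500) :
    ∃ (N : ℕ) (x : Fin N → EuclideanSpace ℝ (Fin 3)) (i : Fin N), Good x i ∧ ¬ Matched 1 ε x i := by
  refine ⟨13, deca, 0, good_deca, ?_⟩
  refine not_matched_of_short_combination ringIdx ringCoeff (fun t => ?_) ?_ ?_
  · rw [dist_comm]; exact dist_deca_zero_le _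
  · rw [norm_sum_ringCoeff_smul, sum_abs_ringCoeff]; nlinarith
  · rw [norm_sum_ringCoeff_smul, sum_abs_ringCoeff]; nlinarith

end Summit.AtomisticToContinuum.Crystallization.Theorems.GapTwelveToBarlow.Negative.FiveFoldShell
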